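import Summits.CriticalPhenomena.PercolationContinuityZ3.Theorems.PercShatteringRaceNearLinearTwoClusterDecayStubLossyStep
import Summits.CriticalPhenomena.PercolationContinuityZ3.Theorems.PercShatteringRaceNearLinearTwoClusterDecayStubRelayChain
import Summits.CriticalPhenomena.PercolationContinuityZ3.Theorems.PercShatteringRaceNearLinearTwoClusterDecayStubBootstrapInit
import Summits.CriticalPhenomena.PercolationContinuityZ3.Theorems.PercShatteringRaceNearLinearTwoClusterDecayStubRelayBootstrap
import Summits.CriticalPhenomena.PercolationContinuityZ3.Theorems.PercShatteringRaceNearLinearTwoClusterDecayConsumedBoxLRO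
import HarnessLib

/-!
# Crux `PercShatteringRace.NearLinearTwoClusterDecay` (stmt-CriticalPhenomena-5785) — the relay-bootstrap certificate

Helper file of the lead (seat c5) of the line `pair-decay-long-arms-dense`; lands with
`--supports stmt-CriticalPhenomena-5785` (registered auxiliary statement `relayBootstrap_certificate`).

**What this certifies.** The crux `U(1/6)` is consumed by the route only through its jump-world
CONSUMED form `JumpBoxLRO b` (in-box long-range order from the centre at aspect `n^{1+b}` when
`θ(p_c) > 0`; `Consumed.raceLemma_of_jumpBoxLRO`, p125450).  The four engine stubs of skeleton rev L5-c5,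
all landed —
* E1 `stub_lossyStep` (Cerf 2015 Lemma 7.1 + Cor 7.2 at relay scale: pair-LRO at aspect `x` and a
  two-arms exponent `κ` give the two-cluster rate `ζ ≤ κA − 6 − 6x` at aspect `A`),
* E2 `stub_relayChain` (the occupation-rate relay: an occupation rate `σ` and a two-cluster rate `ζ` at
  aspect `A` give pair-LRO at every aspect `x > max 1 (γA)` once `γ(1+σ) > 1`, `γ(1+ζ) > 1`),
* E3 `stub_bootstrapInit` (Duminil-Copin–Kozma–Tassion 2020 Prop 1 at `p_c`: SOME two-cluster rate),
* E4 `stub_relayBootstrap` (the round map `x ↦ max (1, (6+6x+σ)/(κ(1+σ)), x/(1+σ))` is a contraction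
  with fixed point `max (1, (6+σ)/(κ(1+σ)−6))`) —
compose to `relayBootstrap_certificate`:

  `TwoArm κ ∧ OccRate σ ⇒ JumpBoxLRO b` whenever `6 < κ(1+σ)` and `(6+σ)/(κ(1+σ)−6) < 1+b`, `b > 0`,

where `TwoArm κ` = "the two-arms event of an edge at scale `m` (`AKN.edgeTwoArms`) has probability
`≤ C m^{-κ}` at `p_c`" (UNCONDITIONAL atom; tree: every `κ < 1/2`, `twoArm_of_lt_half` below; print,
site: `κ < 12/23`, Cerf 2015 Thm 1.1; measured `κ̂ ≈ 1.79`, kit j020669) and `OccRate σ` = "in the jump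
world a box of radius `u` misses the infinite cluster with probability `≤ C u^{-σ}`" (jump-world atom, no
engine known).  Consequences:
* `percolationContinuityZ3_of_powerSaving_of_twoArm_of_occRate`: the free-box power saving `S(a)`
  together with `TwoArm κ` and `OccRate σ` gives `θ(p_c) = 0` on `ℤ³` when `(1+b)(3−a) < 3`;
  instance `(a, b, κ, σ) = (1/2, 1/6, 9/5, 10)` from the route decl `FreeSusceptibilityPowerSaving`;
* `jumpBoxLRO_of_occRate` (UNCONDITIONAL in `κ`, using the tree's AKN two-arms bound): `OccRate σ` with
  `σ > 11` and `2(6+σ)/(σ−11) < 1+b` gives `JumpBoxLRO b` — e.g. `OccRate 35 ⇒` in-box LRO at aspect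
  `n^{3.5}` in the jump world (tree, unconditional: aspect `n^{17}`, `cerf2015BoxLRO16_proof`).
HONEST SCOPE: this does not touch `U` as filed (whose `θ(p_c) = 0` half is the d<6 residue, child 2 of
the line); it certifies the route's consumed form modulo the two typed atoms.
-/

noncomputable section

namespace Summit.CriticalPhenomena.PercolationContinuityZ3.Theorems

namespace NearLinearTwoClusterDecay.RelayBootstrap

open MeasureTheory Filter Topology
open Literature.Probability.LatticeModels Literature.Probability.Percolation

/-- `1 + log m ≤ (1 + 1/ε) m^ε` for `m ≥ 1`, `ε > 0`. [folklore] -/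
theorem one_add_log_le_rpow {ε : ℝ} (hε : 0 < ε) {m : ℝ} (hm : 1 ≤ m) :
    1 + Real.log m ≤ (1 + 1 / ε) * m ^ ε := by
  have h1 : Real.log m ≤ m ^ ε / ε := Real.log_le_rpow_div (by linarith) hε
  have h2 : 1 ≤ m ^ ε := Real.one_le_rpow hm hε.le
  have h3 : (1 + 1 / ε) * m ^ ε = m ^ ε + m ^ ε / ε := by ring
  rw [h3]
  exact add_le_add h2 h1

/-- **`TwoArm κ` for every `κ < 1/2`, unconditionally at `p_c(ℤ³)`**, from the tree's AKN/Cerf bound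
`P_{p}(edgeTwoArms i m) ≤ κ₀ (1 + log m)/√m` uniformly on `p ∈ [δ, 1−δ]` (`AKN.exists_real_edgeTwoArms_le`)
and `p_c ∈ (0,1)` (`Grimmett1999_criticalProb_pos_lt_one_holds`). [cite: Cerf2015, Prop 5.2] -/
theorem twoArm_of_lt_half {κ : ℝ} (hκ : κ < 1 / 2) :
    ∃ C : ℝ, ∀ i : Fin 3, ∀ m : ℕ, 1 ≤ m →
      (bondPercolation (zdGraph 3) (criticalProbI 3)).real (AKN.edgeTwoArms i m) ≤ C * (m : ℝ) ^ (-κ) := by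
  have hpc := Grimmett1999_criticalProb_pos_lt_one_holds 3 (by norm_num)
  have hp0 : 0 < ((criticalProbI 3 : unitInterval) : ℝ) := by rw [coe_criticalProbI]; exact hpc.1
  have hp1 : ((criticalProbI 3 : unitInterval) : ℝ) < 1 := by rw [coe_criticalProbI]; exact hpc.2
  set δ : ℝ := min (min ((criticalProbI 3 : unitInterval) : ℝ) (1 - (criticalProbI 3 : unitInterval))) (1 / 2)
    with hδ
  have hδ0 : 0 < δ := lt_min (lt_min hp0 (by linarith)) (by norm_num)
  have hδh : δ ≤ 1 / 2 := min_le_right _ _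
  have hδp : δ ≤ (criticalProbI 3 : unitInterval) := (min_le_left _ _).trans (min_le_left _ _)
  have hδp' : ((criticalProbI 3 : unitInterval) : ℝ) ≤ 1 - δ := by
    have : δ ≤ 1 - (criticalProbI 3 : unitInterval) := (min_le_left _ _).trans (min_le_right _ _)
    linarith
  obtain ⟨κ₀, hκ₀, h⟩ := AKN.exists_real_edgeTwoArms_le (d := 3) (by norm_num) hδ0 hδh
  set ε : ℝ := 1 / 2 - κ with hε
  have hε0 : 0 < ε := by rw [hε]; linarith
  refine ⟨κ₀ * (1 + 1 / ε), fun i m hm => ?_⟩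
  have hm1 : (1 : ℝ) ≤ m := by exact_mod_cast hm
  have hm0 : (0 : ℝ) < m := by linarith
  have hb := h (criticalProbI 3) hδp hδp' i m hm
  have hlog := one_add_log_le_rpow hε0 hm1
  have hsqrt : Real.sqrt (m : ℝ) = (m : ℝ) ^ (1 / 2 : ℝ) := Real.sqrt_eq_rpow _
  have hsq0 : 0 < Real.sqrt (m : ℝ) := Real.sqrt_pos.2 hm0
  calc (bondPercolation (zdGraph 3) (criticalProbI 3)).real (AKN.edgeTwoArms i m)
      ≤ κ₀ * (1 + Real.log m) / Real.sqrt m := hb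
    _ ≤ κ₀ * ((1 + 1 / ε) * (m : ℝ) ^ ε) / Real.sqrt m := by
        gcongr
    _ = κ₀ * (1 + 1 / ε) * ((m : ℝ) ^ ε / (m : ℝ) ^ (1 / 2 : ℝ)) := by rw [hsqrt]; ring
    _ = κ₀ * (1 + 1 / ε) * (m : ℝ) ^ (-κ) := by
        rw [← Real.rpow_sub hm0]
        congr 2
        rw [hε]; ring

end NearLinearTwoClusterDecay.RelayBootstrap

open MeasureTheory Filter Topology
open Literature.Probability.LatticeModels Literature.Probability.Percolation
open Summit.CriticalPhenomena.PercolationContinuityZ3.Theses.PercShatteringRace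
open NearLinearTwoClusterDecay.RelayBootstrap

/-- **The relay-bootstrap certificate** (registered auxiliary statement of the line
`pair-decay-long-arms-dense`): for real `κ, σ, b > 0` with `6 < κ(1+σ)` and `(6+σ)/(κ(1+σ)−6) < 1+b`,
the two-arms exponent `κ` (`P_{p_c}(edgeTwoArms i m) ≤ C m^{-κ}`) and the jump-world occupation rate `σ`
(`P_{p_c}(Λ_u misses every infinite cluster) ≤ C u^{-σ}`) give in-box long-range order from the centre at
aspect `n^{1+b}` in the jump world `θ(p_c) > 0` — the CONSUMED form of `U`.  Composition of the four landed
engine stubs E1–E4. [folklore] -/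
theorem relayBootstrap_certificate :
    ∀ κ σ b : ℝ, 0 < κ → 0 < σ → 0 < b → 6 < κ * (1 + σ) → (6 + σ) / (κ * (1 + σ) - 6) < 1 + b →
    (∃ C : ℝ, ∀ i : Fin 3, ∀ m : ℕ, 1 ≤ m →
      (bondPercolation (zdGraph 3) (criticalProbI 3)).real (AKN.edgeTwoArms i m) ≤ C * (m : ℝ) ^ (-κ)) →
    (0 < theta (zdGraph 3) 0 (criticalProbI 3) → ∃ C : ℝ, ∀ u : ℕ, 1 ≤ u →
      (bondPercolation (zdGraph 3) (criticalProbI 3)).real {ω | ∀ x ∈ box 3 u, ω ∉ percolatesAt x} ≤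
        C * (u : ℝ) ^ (-σ)) →
    (0 < theta (zdGraph 3) 0 (criticalProbI 3) → ∃ c : ℝ, 0 < c ∧ ∀ᶠ n : ℕ in atTop, ∀ y ∈ box 3 n,
      c ≤ (bondPercolation (zdGraph 3) (criticalProbI 3)).real
        (openConnIn (↑(box 3 ⌈(n : ℝ) ^ (1 + b)⌉₊) : Set (Site 3)) 0 y)) :=
  stub_relayBootstrap stub_relayChain stub_lossyStep stub_bootstrapInit

/-- **The race from the atoms**: for real `a, b, κ, σ` with `0 < b`, `(1+b)(3−a) < 3`, `6 < κ(1+σ)` and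
`(6+σ)/(κ(1+σ)−6) < 1+b`, the free-box power saving `S(a)` (`Σ_{y ∈ Λ_R} P_{p_c}(0 ↔ y in Λ_R) ≤ C R^{3−a}`)
together with `TwoArm κ` and `OccRate σ` gives `θ(p_c) = 0` on `ℤ³`: `relayBootstrap_certificate` and the
landed `Consumed.raceLemma_of_jumpBoxLRO` (p125450). [folklore] -/
theorem percolationContinuityZ3_of_powerSaving_of_twoArm_of_occRate {a b κ σ : ℝ} (hb : 0 < b)
    (hab : (1 + b) * (3 - a) < 3) (hκ : 0 < κ) (hσ : 0 < σ) (h6 : 6 < κ * (1 + σ))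
    (hfix : (6 + σ) / (κ * (1 + σ) - 6) < 1 + b)
    (hS : ∃ C : ℝ, ∀ R : ℕ, 1 ≤ R → ∑ y ∈ box 3 R,
      (bondPercolation (zdGraph 3) (criticalProbI 3)).real (openConnIn (↑(box 3 R) : Set (Site 3)) 0 y)
        ≤ C * (R : ℝ) ^ (3 - a))
    (hT : ∃ C : ℝ, ∀ i : Fin 3, ∀ m : ℕ, 1 ≤ m →
      (bondPercolation (zdGraph 3) (criticalProbI 3)).real (AKN.edgeTwoArms i m) ≤ C * (m : ℝ) ^ (-κ))
    (hO : 0 < theta (zdGraph 3) 0 (criticalProbI 3) → ∃ C : ℝ, ∀ u : ℕ, 1 ≤ u →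
      (bondPercolation (zdGraph 3) (criticalProbI 3)).real {ω | ∀ x ∈ box 3 u, ω ∉ percolatesAt x} ≤
        C * (u : ℝ) ^ (-σ)) :
    _root_.PercolationContinuityZ3 :=
  NearLinearTwoClusterDecay.Consumed.raceLemma_of_jumpBoxLRO a b hb.le hab hS
    (relayBootstrap_certificate κ σ b hκ hσ hb h6 hfix hT hO)

/-- **Instance: the filed race** `(a, b) = (1/2, 1/6)` closes from the route's first crux
`FreeSusceptibilityPowerSaving` (= `S(1/2)`), `TwoArm (9/5)` (measured `κ̂ ≈ 1.79`, kit j020669; NOT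
proved — tree: `κ < 1/2`) and `OccRate 10`: `6 < 19.8` and `16/13.8 < 7/6`. [folklore] -/
theorem percolationContinuityZ3_of_freeSusceptibilityPowerSaving_of_twoArm_of_occRate
    (hS : FreeSusceptibilityPowerSaving)
    (hT : ∃ C : ℝ, ∀ i : Fin 3, ∀ m : ℕ, 1 ≤ m →
      (bondPercolation (zdGraph 3) (criticalProbI 3)).real (AKN.edgeTwoArms i m) ≤
        C * (m : ℝ) ^ (-((9 : ℝ) / 5)))
    (hO : 0 < theta (zdGraph 3) 0 (criticalProbI 3) → ∃ C : ℝ, ∀ u : ℕ, 1 ≤ u →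
      (bondPercolation (zdGraph 3) (criticalProbI 3)).real {ω | ∀ x ∈ box 3 u, ω ∉ percolatesAt x} ≤
        C * (u : ℝ) ^ (-(10 : ℝ))) :
    _root_.PercolationContinuityZ3 := by
  have e : (3 : ℝ) - 1 / 2 = 5 / 2 := by norm_num
  refine percolationContinuityZ3_of_powerSaving_of_twoArm_of_occRate (a := 1 / 2) (b := 1 / 6)
    (κ := 9 / 5) (σ := 10) (by norm_num) (by norm_num) (by norm_num) (by norm_num) (by norm_num)
    (by norm_num) ?_ hT hO
  rw [e]; exact hS

/-- **Any power saving completes the race once `κ > 1`**: if `TwoArm κ` holds for some `κ > 1` and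
`OccRate σ` for some `σ > 0` with `σ(κ − 1) ≥ 12 − κ`, the fixed point of the bootstrap is `1`, so
`JumpBoxLRO b` holds for EVERY `b > 0` and the free-box power saving `S(a)` for ANY `a > 0` gives
`θ(p_c) = 0` (take `b = a/6`).  Instance in the skeleton: `κ = 9/5`, `σ = 13`. [folklore] -/
theorem percolationContinuityZ3_of_powerSaving_of_twoArm_gt_one_of_occRate {a κ σ : ℝ} (ha : 0 < a)
    (hκ : 1 < κ) (hσ : 0 < σ) (hκσ : 12 - κ ≤ σ * (κ - 1))
    (hS : ∃ C : ℝ, ∀ R : ℕ, 1 ≤ R → ∑ y ∈ box 3 R,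
      (bondPercolation (zdGraph 3) (criticalProbI 3)).real (openConnIn (↑(box 3 R) : Set (Site 3)) 0 y)
        ≤ C * (R : ℝ) ^ (3 - a))
    (hT : ∃ C : ℝ, ∀ i : Fin 3, ∀ m : ℕ, 1 ≤ m →
      (bondPercolation (zdGraph 3) (criticalProbI 3)).real (AKN.edgeTwoArms i m) ≤ C * (m : ℝ) ^ (-κ))
    (hO : 0 < theta (zdGraph 3) 0 (criticalProbI 3) → ∃ C : ℝ, ∀ u : ℕ, 1 ≤ u →
      (bondPercolation (zdGraph 3) (criticalProbI 3)).real {ω | ∀ x ∈ box 3 u, ω ∉ percolatesAt x} ≤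
        C * (u : ℝ) ^ (-σ)) :
    _root_.PercolationContinuityZ3 := by
  have h12 : 6 + σ ≤ κ * (1 + σ) - 6 := by nlinarith
  have h6 : 6 < κ * (1 + σ) := by linarith
  have hfix : (6 + σ) / (κ * (1 + σ) - 6) < 1 + a / 6 := by
    have : (6 + σ) / (κ * (1 + σ) - 6) ≤ 1 := (div_le_one (by linarith)).2 h12
    linarith
  exact percolationContinuityZ3_of_powerSaving_of_twoArm_of_occRate (a := a) (b := a / 6)
    (by positivity) (by nlinarith) (by linarith) hσ h6 hfix hS hT hO

/-- **Unconditional in the two-arms exponent**: with the TREE's two-arms bound (`TwoArm κ` for every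
`κ < 1/2`, `twoArm_of_lt_half`), an occupation rate `σ > 11` with `2(6+σ)/(σ−11) < 1+b` alone gives
`JumpBoxLRO b` — e.g. `OccRate 35` gives in-box long-range order at aspect `n^{7/2}` in the jump world
(take `κ` between `(6 + (6+σ)/(1+b))/(1+σ)` and `1/2`). [folklore] -/
theorem jumpBoxLRO_of_occRate {σ b : ℝ} (hσ : 11 < σ) (hb : 0 < b)
    (hfix : 2 * (6 + σ) / (σ - 11) < 1 + b)
    (hO : 0 < theta (zdGraph 3) 0 (criticalProbI 3) → ∃ C : ℝ, ∀ u : ℕ, 1 ≤ u →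
      (bondPercolation (zdGraph 3) (criticalProbI 3)).real {ω | ∀ x ∈ box 3 u, ω ∉ percolatesAt x} ≤
        C * (u : ℝ) ^ (-σ)) :
    0 < theta (zdGraph 3) 0 (criticalProbI 3) → ∃ c : ℝ, 0 < c ∧ ∀ᶠ n : ℕ in atTop, ∀ y ∈ box 3 n,
      c ≤ (bondPercolation (zdGraph 3) (criticalProbI 3)).real
        (openConnIn (↑(box 3 ⌈(n : ℝ) ^ (1 + b)⌉₊) : Set (Site 3)) 0 y) := by
  have hσ11 : 0 < σ - 11 := by linarith
  have h1b : 0 < 1 + b := by linarith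
  -- the threshold exponent `κ₁` and the choice `κ = (κ₁ + 1/2)/2`
  set κ₁ : ℝ := (6 + (6 + σ) / (1 + b)) / (1 + σ) with hκ₁
  have hq : (6 + σ) / (1 + b) < (σ - 11) / 2 := by
    rw [div_lt_iff₀ h1b]
    rw [div_lt_iff₀ hσ11] at hfix
    nlinarith
  have hκ₁h : κ₁ < 1 / 2 := by
    rw [hκ₁, div_lt_iff₀ (by linarith)]
    linarith
  have hκ₁6 : 6 < κ₁ * (1 + σ) := by
    rw [hκ₁, div_mul_cancel₀ _ (by linarith : (1 + σ) ≠ 0)]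
    have : 0 < (6 + σ) / (1 + b) := by positivity
    linarith
  set κ : ℝ := (κ₁ + 1 / 2) / 2 with hκdef
  have hκκ₁ : κ₁ < κ := by rw [hκdef]; linarith
  have hκh : κ < 1 / 2 := by rw [hκdef]; linarith
  have h6 : 6 < κ * (1 + σ) := by nlinarith
  have hκ0 : 0 < κ := by nlinarith
  have hgap : (6 + σ) / (1 + b) < κ * (1 + σ) - 6 := by
    have e1 : κ₁ * (1 + σ) - 6 = (6 + σ) / (1 + b) := by
      rw [hκ₁, div_mul_cancel₀ _ (by linarith : (1 + σ) ≠ 0)]; ring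
    nlinarith
  have hfix' : (6 + σ) / (κ * (1 + σ) - 6) < 1 + b := by
    rw [div_lt_iff₀ (by linarith)]
    rw [div_lt_iff₀ h1b] at hgap
    nlinarith
  exact relayBootstrap_certificate κ σ b hκ0 (by linarith) hb h6 hfix' (twoArm_of_lt_half hκh) hO

end Summit.CriticalPhenomena.PercolationContinuityZ3.Theorems
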